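import Summits.AtomisticToContinuum.Crystallization.Theorems.FreeSplittingCertificatesStrictSplittingRuleP1FarCellJensen
import Summits.AtomisticToContinuum.Crystallization.Theorems.FreeSplittingCertificatesStrictSplittingRuleP1FarCellFrame

/-!
# `StrictSplittingRule` (stmt-AtomisticToContinuum-12560): THE LOAD OF A LEG OF A CELL `≥ 20a` FROM THE BASE — Jensen capacity + midpoint tension (P1 interpolant object, part 96)

Route `FreeSplittingCertificates`, crux r3 `StrictSplittingRule` (H12⋆ = `stub_coreJointCoercive`), unit b2b-freesplit-B gen 40.
VALUE = third brick of the sharper (B∃) tail lemma (kernel radius `44a → 20a`, parts 94–98).  Part 87's `leg_load_le`/`pair_load_le`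
from `20a` instead of `44a`, with the SAME conclusion `θ_T(e)·(W_e + R_e) ≤ J_T·p1LoadCoef` — so the landed class forms of parts 88/89
apply verbatim downstream: the capacity of a leg comes from the Jensen bound of part 94 with the moment tables of part 95 (lever `a/2`
and second-order terms: `X = (27/25)m_b²`), the tension from the midpoint form from `r ≥ 89/5` (`133/125`, part 94), and
`(133/125)(27/25)³ = 1.3403 ≤ Λ* = 1.37525` (`load_bound20`).  Distances: the leg ends are `≥ 20a ≥ 19.42`, every bond midpoint is
`≥ 20a − h ≥ 93/5`, the base of the second vertical bond is `≥ 20a − 2h ≥ 89/5`.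
* `hcpSite_p1SV_eq_frame`, `hcpSite_stencilIn_eq_frame`, `p1FrameVec_two_smul_sub`, `norm_sq_eq_fpSq` (bond midpoints as `fpSq`);
* `load_bound20`, **`leg_load_le20`**, **`pair_load_le20`**, `pair_term_le20`.
NOT a proof of H12⋆, NOT summit progress.  [folklore]
-/

noncomputable section

open Set Function Metric MeasureTheory Filter Topology
open scoped BigOperators NNReal ENNReal Classical

namespace Summit.AtomisticToContinuum.Crystallization.Theorems.StrictSplittingRuleBirth

open Literature.MathematicalPhysics.StatisticalMechanics
open Summit.AtomisticToContinuum.Crystallization.Theorems.PalmUnimodularRigidity.LayeredLawsSelectHcp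

/-! ## Small identities: stencil vectors in the frame, midpoint distances as `fpSq` -/

/-- The vertical Bravais vector in the frame: `y_SV = Φ(0,0,2) = (0,0,2h)`. -/
theorem hcpSite_p1SV_eq_frame (a h : ℝ) (k : Fin 3) : hcpSite a h p1SV k = p1FrameVec a h (0, 0, 2) k := by
  have h2 : haggLabel alternatingHagg 2 = 0 := haggLabel_alternating_of_even (by decide)
  fin_cases k
  · simp [p1SV, hcpSite_apply_zero, h2]
  · simp [p1SV, hcpSite_apply_one, h2]
  · simp [p1SV, hcpSite_apply_two]; ring

/-- In-layer stencil vectors in the frame (parity-free): `y_d = Φ(F_b(d))` for `d ∈ p1StencilIn`. -/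
theorem hcpSite_stencilIn_eq_frame (a h : ℝ) {d : ℤ × ℤ × ℤ} (hd : d ∈ p1StencilIn) (b : Bool) (k : Fin 3) :
    hcpSite a h d k = p1FrameVec a h (p1Frame b d) k := by
  simp only [p1StencilIn, Finset.mem_insert, Finset.mem_singleton] at hd
  rcases hd with rfl | rfl | rfl <;> cases b <;> fin_cases k <;>
    simp [hcpSite_apply_zero, hcpSite_apply_one, hcpSite_apply_two, p1Frame] <;> ring

/-- Linearity used for the second route leg: `Φ(2F − G) = 2Φ(F) − Φ(G)`. -/
theorem p1FrameVec_two_smul_sub (a h : ℝ) (F G : ℤ × ℤ × ℤ) (k : Fin 3) :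
    p1FrameVec a h (2 • F - G) k = 2 * p1FrameVec a h F k - p1FrameVec a h G k := by
  fin_cases k <;> simp <;> ring

/-- `‖v‖² = fpSq v` on `ℝ³`. -/
theorem norm_sq_eq_fpSq (v : EuclideanSpace ℝ (Fin 3)) : ‖v‖ ^ 2 = fpSq (fun k => v k) := by
  rw [norm_sq_eq_three]; rfl

/-! ## The arithmetic of one load from `20a` -/

/-- **One load against the budget (abstract, Jensen form)**: share `θ ≤ J/(nV·((27/25)m²)⁻³)`, weight `W ≤ A(133/125)(m²)⁻³` ⇒
`θ·W ≤ J·(A/(nV))·Λ*` (`(133/125)(27/25)³ ≤ Λ*`). -/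
theorem load_bound20 {θ J W A n V m : ℝ} (hθ0 : 0 ≤ θ) (hJ0 : 0 ≤ J) (hA0 : 0 ≤ A) (hn : 0 < n) (hV : 0 < V) (hm : 0 < m)
    (hθ : θ ≤ J / (n * (V * ((27 / 25 * m ^ 2)⁻¹) ^ 3))) (hW : W ≤ A * (133 / 125) * ((m ^ 2)⁻¹) ^ 3) :
    θ * W ≤ J * (A / (n * V) * p1LamStar) := by
  have hB0 : 0 ≤ A * (133 / 125) * ((m ^ 2)⁻¹) ^ 3 := by positivity
  have hnum : (133 / 125 : ℝ) * (27 / 25) ^ 3 ≤ p1LamStar := by rw [p1LamStar]; norm_num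
  have hJA : 0 ≤ J * (A / (n * V)) := by positivity
  calc θ * W ≤ θ * (A * (133 / 125) * ((m ^ 2)⁻¹) ^ 3) := mul_le_mul_of_nonneg_left hW hθ0
    _ ≤ J / (n * (V * ((27 / 25 * m ^ 2)⁻¹) ^ 3)) * (A * (133 / 125) * ((m ^ 2)⁻¹) ^ 3) := mul_le_mul_of_nonneg_right hθ hB0
    _ = J * (A / (n * V)) * ((133 / 125 : ℝ) * (27 / 25) ^ 3) := by
        have hm' : m ≠ 0 := hm.ne'
        have hn' : n ≠ 0 := hn.ne'
        have hV' : V ≠ 0 := hV.ne'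
        field_simp
    _ ≤ J * (A / (n * V) * p1LamStar) := by nlinarith [mul_le_mul_of_nonneg_left hnum hJA]

/-- **THE LOAD OF ONE LEG OF A CELL `≥ 20a` FROM THE BASE** (part 87's `leg_load_le` from `20a`, same conclusion): for the hcp family
minimiser, any base `p`, a cell `T`, a leg `(x, d)` with `x`, `x + d` at distance `≥ 20a` from `y_p`, `x` of parity `bx`, any shed set `φ`:
`θ_T(x,d)·(p1FarW φ p (x,d) + p1RouteW φ p (x,d)) ≤ J_T·([d ∈ p1StencilIn]·c_in(n) + [d ∈ p1RouteDirs bx]·c_v(n))·Λ*`.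
Capacity by Jensen (parts 94/95), tension at the bond midpoint from `89/5` (part 94).  NOT a proof of H12⋆, NOT summit progress. [folklore] -/
theorem leg_load_le20 {a h : ℝ} (ha : 0 < a) (hh : 0 < h) (hfam : HcpFamilyMin a h) (φ : Finset ((ℤ × ℤ × ℤ) × (ℤ × ℤ × ℤ)))
    (p : ℤ × ℤ × ℤ) (T : (ℤ × ℤ × ℤ) × Fin 6) (x d : ℤ × ℤ × ℤ) {bx : Bool} (hbx : p1Par x = bx)
    (hRx : 20 * a ≤ ‖hcpSite a h x - hcpSite a h p‖) (hRx' : 20 * a ≤ ‖hcpSite a h (x + d) - hcpSite a h p‖) :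
    p1ThetaX a h p (x, d) T * (p1FarW a h φ p (x, d) + p1RouteW a h φ p (x, d)) ≤
      p1CellJ a h p T *
        (((Nat.cast (R := ℝ) (if d ∈ p1StencilIn then (p1Carriers bx d).card else 0))⁻¹ * (2 / (3 * a ^ 2) / (24 * (√3 * a ^ 2 * h / 12))) +
          (Nat.cast (R := ℝ) (if d ∈ p1RouteDirs bx then (p1Carriers bx d).card else 0))⁻¹ *
            (2 * (2 / 3) * (1 / (4 * h ^ 2)) / (24 * (√3 * a ^ 2 * h / 12)))) * p1LamStar) := by
  -- the box
  obtain ⟨hA, hH⟩ := hcpFamilyMin_enclosure ha hh hfam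
  rw [abs_sub_le_iff] at hA hH
  obtain ⟨hA1, hA2⟩ := hA
  obtain ⟨hH1, hH2⟩ := hH
  obtain ⟨hρ1, hρ2⟩ := ratioBox_of_hcpFamilyMin ha hh hfam
  have ha' : a ≤ 8 / 5 := by linarith
  have hh' : h ≤ 4 / 5 := by linarith
  have ha2 : a ≤ 97139 / 100000 := by linarith
  have hh2 : h ≤ 79304 / 100000 := by linarith
  have h3 : 0 < √3 := Real.sqrt_pos.2 (by norm_num)
  have hV0 : 0 < √3 * a ^ 2 * h / 12 := by positivity
  have hϱ0 : 0 ≤ √(4 * a ^ 2 / 3 + h ^ 2) := Real.sqrt_nonneg _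
  have hϱle : √(4 * a ^ 2 / 3 + h ^ 2) ≤ 99 / 70 * a := starRad_le ha hh hρ2
  have hRx18 : 89 / 5 ≤ ‖hcpSite a h x - hcpSite a h p‖ := by linarith
  have hxp : x ≠ p := by
    intro hxp; rw [hxp, sub_self, norm_zero] at hRx; linarith
  have hfarx : 27 / 5 * a + √(4 * a ^ 2 / 3 + h ^ 2) ≤ ‖hcpSite a h x - hcpSite a h p‖ := by linarith
  have hJ0 : 0 ≤ p1CellJ a h p T := p1CellJ_nonneg a h p T
  have hθ0 : 0 ≤ p1ThetaX a h p (x, d) T := p1ThetaX_nonneg a h p (x, d) T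
  have hDx : ∀ k, hcpSite a h (x + d) k - hcpSite a h p k =
      (hcpSite a h x k - hcpSite a h p k) + p1FrameVec a h (p1Frame bx d) k := by
    intro k; rw [← hcpSite_shift_eq_frame a h hbx d k]; ring
  -- the in-layer part
  have part_in : p1ThetaX a h p (x, d) T * p1FarW a h φ p (x, d) ≤ p1CellJ a h p T *
      ((Nat.cast (R := ℝ) (if d ∈ p1StencilIn then (p1Carriers bx d).card else 0))⁻¹ * (2 / (3 * a ^ 2) / (24 * (√3 * a ^ 2 * h / 12))) *
        p1LamStar) := by
    by_cases hdin : d ∈ p1StencilIn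
    · rw [if_pos hdin]
      have hnposN : 0 < (p1Carriers bx d).card := p1Carriers_card_pos_in bx d hdin
      have hnpos : (0 : ℝ) < ((p1Carriers bx d).card : ℝ) := by exact_mod_cast hnposN
      -- the bond midpoint distance
      set mb : ℝ := ‖(hcpSite a h x - hcpSite a h p) + (1 / 2 : ℝ) • hcpSite a h d‖ with hmb
      have hmbge : ‖hcpSite a h x - hcpSite a h p‖ - 1 / 2 * a ≤ mb := by
        have := norm_add_half_ge (hcpSite a h x - hcpSite a h p) (hcpSite a h d)
        rw [norm_stencilIn ha hdin] at this
        linarith only [this]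
      have hmb0 : 0 ≤ mb := norm_nonneg _
      have hmb1 : 93 / 5 ≤ mb := by linarith
      have hmbpos : 0 < mb := by linarith
      have hDμ : fpSq ((fun k => hcpSite a h x k - hcpSite a h p k) + fun k => p1FrameVec a h (p1Frame bx d) k / 2) = mb ^ 2 := by
        rw [hmb, norm_sq_eq_fpSq]
        congr 1
        funext k
        simp only [PiLp.add_apply, PiLp.sub_apply, PiLp.smul_apply, smul_eq_mul, Pi.add_apply,
          hcpSite_stencilIn_eq_frame a h hdin bx k]
        ring
      -- capacity by Jensen
      have hmom := carriers_moment_le ha hh ha2 hh2 p x d hbx (p1CarCheck_in bx d hdin) hnposN hmb0 hmb1 hDμ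
      have hX : (0 : ℝ) < 27 / 25 * mb ^ 2 := mul_pos (by norm_num) (pow_pos hmbpos 2)
      have hcap := cap_ge_carriers_tangent ha hh p x d hbx hfarx hX hmom
      have hL : (0 : ℝ) < ((p1Carriers bx d).card : ℝ) * (√3 * a ^ 2 * h / 12 * ((27 / 25 * mb ^ 2)⁻¹) ^ 3) :=
        mul_pos hnpos (mul_pos hV0 (pow_pos (inv_pos.2 hX) 3))
      have hθle := p1ThetaX_le_div T hL hcap
      -- tension at the midpoint
      have hlam : p1TrussLam a h d = 2 / (3 * a ^ 2) := by rw [p1TrussLam_eq, if_pos (p1StencilIn_fst hdin)]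
      have hW := p1FarW_le_mid18 ha hh ha' hh' φ p x d (p1StencilIn_subset hdin) hxp hRx18
      rw [hlam] at hW
      have hA0 : (0 : ℝ) ≤ 2 / (3 * a ^ 2) / 24 := by positivity
      have hW' : p1FarW a h φ p (x, d) ≤ 2 / (3 * a ^ 2) / 24 * (133 / 125) * ((mb ^ 2)⁻¹) ^ 3 := hW
      have key := load_bound20 hθ0 hJ0 hA0 hnpos hV0 hmbpos hθle hW'
      refine key.trans (le_of_eq ?_)
      generalize p1CellJ a h p T = J
      generalize ((p1Carriers bx d).card : ℝ) = n
      generalize p1LamStar = L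
      ring
    · rw [if_neg hdin, p1FarW_eq_zero_of φ p x hdin, mul_zero, Nat.cast_zero, inv_zero, zero_mul, zero_mul, mul_zero]
  -- the routed vertical part
  have part_v : p1ThetaX a h p (x, d) T * p1RouteW a h φ p (x, d) ≤ p1CellJ a h p T *
      ((Nat.cast (R := ℝ) (if d ∈ p1RouteDirs bx then (p1Carriers bx d).card else 0))⁻¹ *
        (2 * (2 / 3) * (1 / (4 * h ^ 2)) / (24 * (√3 * a ^ 2 * h / 12))) * p1LamStar) := by
    by_cases hdv : d ∈ p1RouteDirs bx
    · rw [if_pos hdv]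
      have hnposN : 0 < (p1Carriers bx d).card := p1Carriers_card_pos_route bx d hdv
      have hnpos : (0 : ℝ) < ((p1Carriers bx d).card : ℝ) := by exact_mod_cast hnposN
      have hlam : p1TrussLam a h p1SV = 1 / (4 * h ^ 2) := by rw [p1TrussLam_eq, if_neg (by decide : ¬(p1SV.1 = 0))]
      have hA0 : (0 : ℝ) ≤ 1 / (4 * h ^ 2) / 24 := by positivity
      -- bond 1 (based at `x`): midpoint `y_x + (0,0,h)`
      set m₁ : ℝ := ‖(hcpSite a h x - hcpSite a h p) + (1 / 2 : ℝ) • hcpSite a h p1SV‖ with hm₁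
      have hm₁ge : ‖hcpSite a h x - hcpSite a h p‖ - h ≤ m₁ := by
        have := norm_add_half_ge (hcpSite a h x - hcpSite a h p) (hcpSite a h p1SV)
        rw [norm_p1SV hh] at this
        linarith only [this]
      have hm₁0 : 0 ≤ m₁ := norm_nonneg _
      have hm₁1 : 93 / 5 ≤ m₁ := by linarith
      have hm₁pos : 0 < m₁ := by linarith
      have hDμ₁ : fpSq ((fun k => hcpSite a h x k - hcpSite a h p k) + fun k => p1FrameVec a h (0, 0, 2) k / 2) = m₁ ^ 2 := by
        rw [hm₁, norm_sq_eq_fpSq]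
        congr 1
        funext k
        simp only [PiLp.add_apply, PiLp.sub_apply, PiLp.smul_apply, smul_eq_mul, Pi.add_apply, hcpSite_p1SV_eq_frame a h k]
        ring
      have hmom₁ := carriers_moment_le ha hh ha2 hh2 p x d hbx (p1CarCheck_v1 bx d hdv) hnposN hm₁0 hm₁1 hDμ₁
      have hX₁ : (0 : ℝ) < 27 / 25 * m₁ ^ 2 := mul_pos (by norm_num) (pow_pos hm₁pos 2)
      have hcap₁ := cap_ge_carriers_tangent ha hh p x d hbx hfarx hX₁ hmom₁
      have hL₁ : (0 : ℝ) < ((p1Carriers bx d).card : ℝ) * (√3 * a ^ 2 * h / 12 * ((27 / 25 * m₁ ^ 2)⁻¹) ^ 3) :=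
        mul_pos hnpos (mul_pos hV0 (pow_pos (inv_pos.2 hX₁) 3))
      have hθ₁ := p1ThetaX_le_div T hL₁ hcap₁
      have hW₁ := p1FarWv_le_mid18 ha hh ha' hh' φ p x hxp hRx18
      rw [hlam] at hW₁
      have hW₁' : p1FarWv a h φ p x ≤ 1 / (4 * h ^ 2) / 24 * (133 / 125) * ((m₁ ^ 2)⁻¹) ^ 3 := hW₁
      have key₁ := load_bound20 hθ0 hJ0 hA0 hnpos hV0 hm₁pos hθ₁ (le_refl (1 / (4 * h ^ 2) / 24 * (133 / 125) * ((m₁ ^ 2)⁻¹) ^ 3))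
      -- bond 2 (based at `x − (SV − d)`, head `x + d`): midpoint `y_{x+d} − (0,0,h)`
      have hq'x : x - (p1SV - d) + p1SV = x + d := by abel
      have hvec : hcpSite a h (x + d) - hcpSite a h (x - (p1SV - d)) = hcpSite a h p1SV := by
        rw [← hq'x]; exact sub_eq_p1SV a h _
      have hRqge : ‖hcpSite a h (x + d) - hcpSite a h p‖ - 2 * h ≤ ‖hcpSite a h (x - (p1SV - d)) - hcpSite a h p‖ := by
        have htri := norm_sub_le_norm_sub_add_norm_sub (hcpSite a h (x + d)) (hcpSite a h (x - (p1SV - d))) (hcpSite a h p)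
        rw [hvec, norm_p1SV hh] at htri
        linarith only [htri]
      have hRq18 : 89 / 5 ≤ ‖hcpSite a h (x - (p1SV - d)) - hcpSite a h p‖ := by linarith only [hRqge, hRx', hA2, hH1]
      have hq'p : x - (p1SV - d) ≠ p := by
        intro hq; rw [hq, sub_self, norm_zero] at hRq18; linarith only [hRq18]
      have hid : (hcpSite a h (x - (p1SV - d)) - hcpSite a h p) + (1 / 2 : ℝ) • hcpSite a h p1SV =
          (hcpSite a h (x + d) - hcpSite a h p) + (1 / 2 : ℝ) • (-hcpSite a h p1SV) := by
        rw [← hvec, smul_neg]; module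
      set m₂ : ℝ := ‖(hcpSite a h (x - (p1SV - d)) - hcpSite a h p) + (1 / 2 : ℝ) • hcpSite a h p1SV‖ with hm₂
      have hm₂ge : ‖hcpSite a h (x + d) - hcpSite a h p‖ - h ≤ m₂ := by
        have := norm_add_half_ge (hcpSite a h (x + d) - hcpSite a h p) (-hcpSite a h p1SV)
        rw [norm_neg, norm_p1SV hh, ← hid] at this
        linarith only [this]
      have hm₂0 : 0 ≤ m₂ := norm_nonneg _
      have hm₂1 : 93 / 5 ≤ m₂ := by linarith
      have hm₂pos : 0 < m₂ := by linarith
      have hDμ₂ : fpSq ((fun k => hcpSite a h x k - hcpSite a h p k) + fun k => p1FrameVec a h (2 • p1Frame bx d - (0, 0, 2)) k / 2) = m₂ ^ 2 := by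
        rw [hm₂, hid, norm_sq_eq_fpSq]
        congr 1
        funext k
        simp only [PiLp.add_apply, PiLp.sub_apply, PiLp.smul_apply, PiLp.neg_apply, smul_eq_mul, Pi.add_apply, hDx k,
          hcpSite_p1SV_eq_frame a h k, p1FrameVec_two_smul_sub]
        ring
      have hmom₂ := carriers_moment_le ha hh ha2 hh2 p x d hbx (p1CarCheck_v2 bx d hdv) hnposN hm₂0 hm₂1 hDμ₂
      have hX₂ : (0 : ℝ) < 27 / 25 * m₂ ^ 2 := mul_pos (by norm_num) (pow_pos hm₂pos 2)
      have hcap₂ := cap_ge_carriers_tangent ha hh p x d hbx hfarx hX₂ hmom₂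
      have hL₂ : (0 : ℝ) < ((p1Carriers bx d).card : ℝ) * (√3 * a ^ 2 * h / 12 * ((27 / 25 * m₂ ^ 2)⁻¹) ^ 3) :=
        mul_pos hnpos (mul_pos hV0 (pow_pos (inv_pos.2 hX₂) 3))
      have hθ₂ := p1ThetaX_le_div T hL₂ hcap₂
      have hW₂ := p1FarWv_le_mid18 ha hh ha' hh' φ p (x - (p1SV - d)) hq'p hRq18
      rw [hlam] at hW₂
      have hW₂' : p1FarWv a h φ p (x - (p1SV - d)) ≤ 1 / (4 * h ^ 2) / 24 * (133 / 125) * ((m₂ ^ 2)⁻¹) ^ 3 := hW₂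
      have key₂ := load_bound20 hθ0 hJ0 hA0 hnpos hV0 hm₂pos hθ₂ (le_refl (1 / (4 * h ^ 2) / 24 * (133 / 125) * ((m₂ ^ 2)⁻¹) ^ 3))
      -- the routed weight against the two bounds
      have hB₁ : (0 : ℝ) ≤ 1 / (4 * h ^ 2) / 24 * (133 / 125) * ((m₁ ^ 2)⁻¹) ^ 3 :=
        mul_nonneg (mul_nonneg hA0 (by norm_num)) (pow_nonneg (inv_nonneg.2 (sq_nonneg _)) 3)
      have hB₂ : (0 : ℝ) ≤ 1 / (4 * h ^ 2) / 24 * (133 / 125) * ((m₂ ^ 2)⁻¹) ^ 3 :=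
        mul_nonneg (mul_nonneg hA0 (by norm_num)) (pow_nonneg (inv_nonneg.2 (sq_nonneg _)) 3)
      have hRle := p1RouteW_le φ p x d hB₁ hB₂ hW₁' hW₂'
      have fin := route_combine hθ0 hRle key₁ key₂
      refine fin.trans (le_of_eq ?_)
      generalize p1CellJ a h p T = J
      generalize ((p1Carriers bx d).card : ℝ) = n
      generalize p1LamStar = L
      ring
    · rw [if_neg hdv, p1RouteW_eq_zero_of φ p x (hbx ▸ hdv), mul_zero, Nat.cast_zero, inv_zero, zero_mul, zero_mul, mul_zero]
  rw [mul_add, add_mul, mul_add]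
  exact add_le_add part_in part_v

/-- **The load of one vertex pair of a cell `≥ 20a` from the base**: `θ_T(e)·(p1FarW e + p1RouteW e) ≤ J_T · p1LoadCoef b π m m'`. [folklore] -/
theorem pair_load_le20 {a h : ℝ} (ha : 0 < a) (hh : 0 < h) (hfam : HcpFamilyMin a h) (φ : Finset ((ℤ × ℤ × ℤ) × (ℤ × ℤ × ℤ)))
    (p : ℤ × ℤ × ℤ) (T : (ℤ × ℤ × ℤ) × Fin 6) {b : Bool} (hb : p1Par T.1 = b) (m m' : Fin 4)
    (hRm : 20 * a ≤ ‖hcpSite a h (T.1 + p1VertOff b T.2 m) - hcpSite a h p‖)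
    (hRm' : 20 * a ≤ ‖hcpSite a h (T.1 + p1VertOff b T.2 m') - hcpSite a h p‖) :
    p1ThetaX a h p (T.1 + p1VertOff b T.2 m, p1VertOff b T.2 m' - p1VertOff b T.2 m) T *
        (p1FarW a h φ p (T.1 + p1VertOff b T.2 m, p1VertOff b T.2 m' - p1VertOff b T.2 m) +
          p1RouteW a h φ p (T.1 + p1VertOff b T.2 m, p1VertOff b T.2 m' - p1VertOff b T.2 m)) ≤
      p1CellJ a h p T * p1LoadCoef a h b T.2 m m' := by
  have hbx : p1Par (T.1 + p1VertOff b T.2 m) = parOf b (p1VertOff b T.2 m) := by rw [p1Par_add, hb]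
  have hxd : T.1 + p1VertOff b T.2 m + (p1VertOff b T.2 m' - p1VertOff b T.2 m) = T.1 + p1VertOff b T.2 m' := by abel
  have key := leg_load_le20 ha hh hfam φ p T (T.1 + p1VertOff b T.2 m) (p1VertOff b T.2 m' - p1VertOff b T.2 m) hbx hRm
    (by rw [hxd]; exact hRm')
  rw [p1LoadCoef, p1LoadNIn, p1LoadNV]
  exact key

/-- One vertex pair's term of the budget against `J_T · p1LoadCoef · Σ_k ⟪δ, G_{·k}⟫²`, cells `≥ 20a` from the base (part 90's `pair_term_le`). -/
theorem pair_term_le20 {a h : ℝ} (ha : 0 < a) (hh : 0 < h) (hfam : HcpFamilyMin a h) (φ : Finset ((ℤ × ℤ × ℤ) × (ℤ × ℤ × ℤ)))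
    (p : ℤ × ℤ × ℤ) (T : (ℤ × ℤ × ℤ) × Fin 6)
    (hfar : ∀ m : Fin 4, 20 * a ≤ ‖hcpSite a h (T.1 + p1VertOff (p1Par T.1) T.2 m) - hcpSite a h p‖)
    (G : Fin 3 → Fin 3 → ℝ) (m m' : Fin 4) :
    let e : (ℤ × ℤ × ℤ) × (ℤ × ℤ × ℤ) := (T.1 + p1VertOff (p1Par T.1) T.2 m, p1VertOff (p1Par T.1) T.2 m' - p1VertOff (p1Par T.1) T.2 m)
    p1ThetaX a h p e T * p1FarW a h φ p e *
        fpSq (fun k => (hcpSite a h (e.1 + e.2) 0 - hcpSite a h e.1 0) * G 0 k +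
          (hcpSite a h (e.1 + e.2) 1 - hcpSite a h e.1 1) * G 1 k + (hcpSite a h (e.1 + e.2) 2 - hcpSite a h e.1 2) * G 2 k) +
      p1ThetaX a h p e T * p1RouteW a h φ p e *
        fpSq (fun k => (hcpSite a h (e.1 + e.2) 0 - hcpSite a h e.1 0) * G 0 k +
          (hcpSite a h (e.1 + e.2) 1 - hcpSite a h e.1 1) * G 1 k + (hcpSite a h (e.1 + e.2) 2 - hcpSite a h e.1 2) * G 2 k) ≤
      p1CellJ a h p T * (p1LoadCoef a h (p1Par T.1) T.2 m m' *
        ((p1EdgeVec a h (p1Par T.1) T.2 m m' 0 * G 0 0 + p1EdgeVec a h (p1Par T.1) T.2 m m' 1 * G 1 0 + p1EdgeVec a h (p1Par T.1) T.2 m m' 2 * G 2 0) ^ 2 +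
         (p1EdgeVec a h (p1Par T.1) T.2 m m' 0 * G 0 1 + p1EdgeVec a h (p1Par T.1) T.2 m m' 1 * G 1 1 + p1EdgeVec a h (p1Par T.1) T.2 m m' 2 * G 2 1) ^ 2 +
         (p1EdgeVec a h (p1Par T.1) T.2 m m' 0 * G 0 2 + p1EdgeVec a h (p1Par T.1) T.2 m m' 1 * G 1 2 + p1EdgeVec a h (p1Par T.1) T.2 m m' 2 * G 2 2) ^ 2)) := by
  intro e
  have hx : e.1 + e.2 = T.1 + p1VertOff (p1Par T.1) T.2 m' := by
    show T.1 + p1VertOff (p1Par T.1) T.2 m + (p1VertOff (p1Par T.1) T.2 m' - p1VertOff (p1Par T.1) T.2 m) = _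
    abel
  have he1 : e.1 = T.1 + p1VertOff (p1Par T.1) T.2 m := rfl
  have hvec : ∀ j : Fin 3, hcpSite a h (e.1 + e.2) j - hcpSite a h e.1 j = p1EdgeVec a h (p1Par T.1) T.2 m m' j := by
    intro j; rw [hx, he1]; exact edgeVec_eq a h T rfl m m' j
  have hF : fpSq (fun k => (hcpSite a h (e.1 + e.2) 0 - hcpSite a h e.1 0) * G 0 k +
      (hcpSite a h (e.1 + e.2) 1 - hcpSite a h e.1 1) * G 1 k + (hcpSite a h (e.1 + e.2) 2 - hcpSite a h e.1 2) * G 2 k) =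
      (p1EdgeVec a h (p1Par T.1) T.2 m m' 0 * G 0 0 + p1EdgeVec a h (p1Par T.1) T.2 m m' 1 * G 1 0 + p1EdgeVec a h (p1Par T.1) T.2 m m' 2 * G 2 0) ^ 2 +
      (p1EdgeVec a h (p1Par T.1) T.2 m m' 0 * G 0 1 + p1EdgeVec a h (p1Par T.1) T.2 m m' 1 * G 1 1 + p1EdgeVec a h (p1Par T.1) T.2 m m' 2 * G 2 1) ^ 2 +
      (p1EdgeVec a h (p1Par T.1) T.2 m m' 0 * G 0 2 + p1EdgeVec a h (p1Par T.1) T.2 m m' 1 * G 1 2 + p1EdgeVec a h (p1Par T.1) T.2 m m' 2 * G 2 2) ^ 2 := by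
    simp only [fpSq, hvec]
  rw [hF, ← add_mul]
  have hF0 : 0 ≤ (p1EdgeVec a h (p1Par T.1) T.2 m m' 0 * G 0 0 + p1EdgeVec a h (p1Par T.1) T.2 m m' 1 * G 1 0 + p1EdgeVec a h (p1Par T.1) T.2 m m' 2 * G 2 0) ^ 2 +
      (p1EdgeVec a h (p1Par T.1) T.2 m m' 0 * G 0 1 + p1EdgeVec a h (p1Par T.1) T.2 m m' 1 * G 1 1 + p1EdgeVec a h (p1Par T.1) T.2 m m' 2 * G 2 1) ^ 2 +
      (p1EdgeVec a h (p1Par T.1) T.2 m m' 0 * G 0 2 + p1EdgeVec a h (p1Par T.1) T.2 m m' 1 * G 1 2 + p1EdgeVec a h (p1Par T.1) T.2 m m' 2 * G 2 2) ^ 2 := by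
    positivity
  have key := pair_load_le20 ha hh hfam φ p T (b := p1Par T.1) rfl m m' (hfar m) (hfar m')
  rw [mul_add] at key
  rw [← mul_assoc]
  exact mul_le_mul_of_nonneg_right key hF0

end Summit.AtomisticToContinuum.Crystallization.Theorems.StrictSplittingRuleBirth

end
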